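import Mathlib
import HarnessLib
import Summits.HubbardSuperconductivity.HubbardSuperconductivity.Theorems.KLProgrammeKLRegimeEnginePairTransferRelStep
import Summits.HubbardSuperconductivity.HubbardSuperconductivity.Theorems.KLProgrammeKLRegimeEnginePairLadderTowerCompose

/-!
# Route `KLProgramme` — ENGINE child gen 8 (stmt-HubbardSuperconductivity-20437 `KLRegimeEngineV17F2`), skeleton v2 class #5 «(S)-transfer» rev 3 (RELATIVE family,
# INDEX form of record (R54ab)): the RE-FRAME DOOR of the relative forward relation — `kltc_relResidue_perturb_le`, `kltc_fwd_reframe`, `kltc_relSource_le`,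
# `PairTransferRelAt.fwd_global`, `PairTransferRelAt.start_reframe` (cell gate-hubbard-kl, seat hubbard-kl-k3c1-p1 g11, technique «composed-map remainder propagation»)

WHY.  The class-#5 producer door `pairTransferRelAt_succ` (p586440) takes, per pair class, the HISTORY forward relation on the START arrays of the two slice flows:
`(1 + diag a(0)·A₂(0))·M₀ = 1`, `‖A₁(0) − A₂(0)·M₀‖ ≤ R₀`.  The history the induction holds is the relative clause `PairTransferRelAt … n Tb ψ₁ʰ ψ₂ʰ` of the pair
`(s_{n,m} | s_{n,m′})` — arrays `klMemberArrayF … n ψᵢʰ` and pinned weights `t_n[ψᵢʰ]` at the OLD frame `K_n` — while the flows of slice `n+1` start from the same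
members read at the NEW frame `K_{n+1}` (scheme F-II, one-shot carriers).  Located item (F)(i) (plan g21 (R54ab): «RELATIVE VALUE DOOR», k3c2-p2 lineage) supplies the
frame shift of these objects; THIS file is the algebra that carries a forward relation across ANY perturbation of `(A₁, A₂, a)` with a residue that stays
PROPORTIONAL TO THE PAIR'S OWN SMALLNESS — the composed-map remainder propagation is done in the relative residue `Ẽ := A₁ + A₁·diag a·A₂ − A₂` (no inverse is
perturbed; `kltc_relResidue_le_of_fwd` / `kltc_fwd_of_relResidue`, p584594, convert at both ends):

* `kltc_relResidue_sub_eq` (exact): `Ẽ′ − Ẽ = [(A₁′−A₁) − (A₂′−A₂)] + (A₁′−A₁)·diag a′·A₂′ + A₁·(diag a′ − diag a)·A₂′ + A₁·diag a·(A₂′−A₂)` — every term after the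
  first carries a weight `a` or `a′`;
* **`kltc_relResidue_perturb_le`**: `‖Ẽ′(x,y)‖ ≤ E(x,y) + η_rel(x,y) + m·Σ_c η₁(x,c)‖a′_c‖ + m²·Σ_c d_c + m·Σ_c ‖a_c‖·η₂(c,y)` from `‖Ẽ‖ ≤ E`, the RELATIVE value shift
  `‖(A₁′−A₁) − (A₂′−A₂)‖ ≤ η_rel`, the absolute shifts `‖Aᵢ′ − Aᵢ‖ ≤ ηᵢ`, the weight shift `‖a′_c − a_c‖ ≤ d_c`, `|A₁|, |A₂′| ≤ m`;
* **`kltc_fwd_reframe`**: forward relation for `(A₁, A₂, a)` with residue `R` + the five majorants + `m·Σ‖a′‖ ≤ 1/3` ⟹ a TWO-SIDED inverse `N` of `1 + diag a′·A₂′` with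
  `‖(A₁′ − A₂′N)(x,y)‖ ≤ T(x,y) + Σ_c T(x,c)‖a′_c‖(3m/2)` for any `T ≥ R + Σ_c R(x,c)‖a_c‖m + η_rel + m·Σ η₁‖a′‖ + m²Σd + m·Σ‖a‖η₂` — the three numbers the (F)(i) lane
  delivers per pair are `η_rel` (relative value shift, ∝ the pair's soft mass), `η₂` (absolute member shift; it only enters × `m·Σ‖a‖`), `d` (pinned-weight re-frame);
* **`kltc_relSource_le`** (+ `_unif`): the relative source of `kltc_relative_flow_duhamel` obeys `‖(S₁(1 + diag a A₂) + A₁ diag a S₂ − S₂)(x,y)‖ ≤ σ_Δ(x,y) +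
  m·Σ_c σ₁(x,c)‖a_c‖ + m·Σ_c ‖a_c‖σ₂(c,y)` from `‖S₁ − S₂‖ ≤ σ_Δ`, `‖Sᵢ‖ ≤ σᵢ`, `|A₁|,|A₂| ≤ m` — the SHAPE the analytic lanes fill (`σ_Δ` = the D-line source
  difference ∝ the pair's soft mass, KLTC-INDEX-v7 §B.3);
* **`PairTransferRelAt.fwd_global`**: the history clause, per pair class `Qm` at resolution `n`, in the door's convention — a two-sided inverse `N` of
  `1 + diag aʰ·A₂ʰ` (`aʰ = −(t_n[ψ₁] − t_n[ψ₂])`, `Aᵢʰ = klMemberArrayF … n ψᵢ Qm`) with the GLOBAL residue `‖(A₁ʰ − A₂ʰN)(x,y)‖ ≤ 𝟙[x,y ∈ ball]·Tb Qm x y` (off the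
  bare ball both sides vanish: `klMemberArrayF_eq_zero_off` + `kltc_mul_rightInv_apply_eq_zero`);
* **`PairTransferRelAt.start_reframe`**: the two composed — from `PairTransferRelAt … n Tb ψ₁ ψ₂`, a class `Qm` at resolution `n`, ANY start data `(A₁⁰, A₂⁰, a⁰)` with
  the five majorants against `(A₁ʰ, A₂ʰ, aʰ)` and `m·Σ‖a⁰‖ ≤ 1/3`: `∃ M₀` two-sided inverse of `1 + diag a⁰·A₂⁰` with `‖(A₁⁰ − A₂⁰M₀)(x,y)‖ ≤ T(x,y) + Σ_c T(x,c)‖a⁰_c‖(3m/2)`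
  — literally the `hM₀`/`hR₀` inputs of `pairTransferRelAt_succ` at scale `n+1` (class at `n+1` ⇒ class at `n` by `isPairClassAt_mono`).
Matrix algebra over landed lemmas only; nothing about the model's sizes is asserted; nothing asserts superconductivity.  0 kit.
-/

noncomputable section

namespace Summit.HubbardSuperconductivity.HubbardSuperconductivity.Theorems.KLRegimeSplit

set_option linter.dupNamespace false -- summit = problem name (single-conjunct summit), D-0017

open Finset Matrix Set Literature.MathematicalPhysics.QuantumLattice Literature.Probability.LatticeModels
open Summit.HubbardSuperconductivity.HubbardSuperconductivity.Theorems.KLProgrammeCooperResummation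
open Summit.HubbardSuperconductivity.HubbardSuperconductivity.Theorems.KLProgrammeLegKernels
open Summit.HubbardSuperconductivity.HubbardSuperconductivity.Theorems.DispersionFlow

/-! ## §1 Perturbation of the relative residue (exact identity, entrywise bound) -/

section Algebra

variable {ι : Type*} [Fintype ι] [DecidableEq ι]

/-- **Exact difference of two relative residues.**  Every term after the relative value shift carries a weight. -/
theorem kltc_relResidue_sub_eq (A₁ A₂ A₁' A₂' : Matrix ι ι ℂ) (a a' : ι → ℂ) :
    (A₁' + A₁' * diagonal a' * A₂' - A₂') - (A₁ + A₁ * diagonal a * A₂ - A₂) =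
      ((A₁' - A₁) - (A₂' - A₂)) +
        ((A₁' - A₁) * diagonal a' * A₂' + A₁ * (diagonal a' - diagonal a) * A₂' + A₁ * diagonal a * (A₂' - A₂)) := by
  noncomm_ring

/-- Entries of `A·(diag a′ − diag a)·B`: `Σ_c A(x,c)·(a′_c − a_c)·B(c,y)`. -/
theorem kltc_mul_diagSub_mul_apply (A B : Matrix ι ι ℂ) (a a' : ι → ℂ) (x y : ι) :
    (A * (diagonal a' - diagonal a) * B) x y = ∑ c, A x c * (a' c - a c) * B c y := by
  rw [diagonal_sub, klli_mul_diag_mul_apply]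

/-- **Entrywise perturbation bound of the relative residue** (composed-map remainder propagation in `Ẽ`; no inverse perturbed). -/
theorem kltc_relResidue_perturb_le (A₁ A₂ A₁' A₂' : Matrix ι ι ℂ) (a a' : ι → ℂ) (E ηr η₁ η₂ : ι → ι → ℝ) (d : ι → ℝ) {m : ℝ} (hm : 0 ≤ m)
    (hA₁ : ∀ x y, ‖A₁ x y‖ ≤ m) (hA₂' : ∀ x y, ‖A₂' x y‖ ≤ m)
    (hE : ∀ x y, ‖(A₁ + A₁ * diagonal a * A₂ - A₂) x y‖ ≤ E x y)
    (hηr : ∀ x y, ‖((A₁' - A₁) - (A₂' - A₂)) x y‖ ≤ ηr x y)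
    (hη₁ : ∀ x y, ‖(A₁' - A₁) x y‖ ≤ η₁ x y) (hη₂ : ∀ x y, ‖(A₂' - A₂) x y‖ ≤ η₂ x y) (hd : ∀ c, ‖a' c - a c‖ ≤ d c) (x y : ι) :
    ‖(A₁' + A₁' * diagonal a' * A₂' - A₂') x y‖ ≤
      E x y + ηr x y + m * ∑ c, η₁ x c * ‖a' c‖ + m * m * ∑ c, d c + m * ∑ c, ‖a c‖ * η₂ c y := by
  have e : (A₁' + A₁' * diagonal a' * A₂' - A₂') =
      (A₁ + A₁ * diagonal a * A₂ - A₂) + (((A₁' - A₁) - (A₂' - A₂)) +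
        ((A₁' - A₁) * diagonal a' * A₂' + A₁ * (diagonal a' - diagonal a) * A₂' + A₁ * diagonal a * (A₂' - A₂))) := by
    rw [← kltc_relResidue_sub_eq]; abel
  have hrhs : E x y + ηr x y + m * ∑ c, η₁ x c * ‖a' c‖ + m * m * ∑ c, d c + m * ∑ c, ‖a c‖ * η₂ c y =
      E x y + (ηr x y + ((m * ∑ c, η₁ x c * ‖a' c‖ + m * m * ∑ c, d c) + m * ∑ c, ‖a c‖ * η₂ c y)) := by ring
  rw [e, Matrix.add_apply, Matrix.add_apply, Matrix.add_apply, Matrix.add_apply, hrhs]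
  refine (norm_add_le _ _).trans (add_le_add (hE x y) ((norm_add_le _ _).trans (add_le_add (hηr x y) ?_)))
  refine (norm_add_le _ _).trans (add_le_add ((norm_add_le _ _).trans (add_le_add ?_ ?_)) ?_)
  · -- `(A₁′ − A₁)·diag a′·A₂′`
    rw [klli_mul_diag_mul_apply, Finset.mul_sum]
    refine (norm_sum_le _ _).trans (sum_le_sum fun c _ => ?_)
    rw [norm_mul, norm_mul]
    have h0 : 0 ≤ η₁ x c := (norm_nonneg _).trans (hη₁ x c)
    calc ‖(A₁' - A₁) x c‖ * ‖a' c‖ * ‖A₂' c y‖ ≤ η₁ x c * ‖a' c‖ * m :=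
          mul_le_mul (mul_le_mul_of_nonneg_right (hη₁ x c) (norm_nonneg _)) (hA₂' c y) (norm_nonneg _) (mul_nonneg h0 (norm_nonneg _))
      _ = m * (η₁ x c * ‖a' c‖) := by ring
  · -- `A₁·(diag a′ − diag a)·A₂′`
    rw [kltc_mul_diagSub_mul_apply, Finset.mul_sum]
    refine (norm_sum_le _ _).trans (sum_le_sum fun c _ => ?_)
    rw [norm_mul, norm_mul]
    calc ‖A₁ x c‖ * ‖a' c - a c‖ * ‖A₂' c y‖ ≤ m * d c * m :=
          mul_le_mul (mul_le_mul (hA₁ x c) (hd c) (norm_nonneg _) hm) (hA₂' c y) (norm_nonneg _)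
            (mul_nonneg hm ((norm_nonneg _).trans (hd c)))
      _ = m * m * d c := by ring
  · -- `A₁·diag a·(A₂′ − A₂)`
    rw [klli_mul_diag_mul_apply, Finset.mul_sum]
    refine (norm_sum_le _ _).trans (sum_le_sum fun c _ => ?_)
    rw [norm_mul, norm_mul]
    calc ‖A₁ x c‖ * ‖a c‖ * ‖(A₂' - A₂) c y‖ ≤ m * ‖a c‖ * η₂ c y :=
          mul_le_mul (mul_le_mul_of_nonneg_right (hA₁ x c) (norm_nonneg _)) (hη₂ c y) (norm_nonneg _)
            (mul_nonneg hm (norm_nonneg _))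
      _ = m * (‖a c‖ * η₂ c y) := by ring

/-- **The relative source majorant (shape).**  `X_rel := S₁(1 + diag a·A₂) + A₁·diag a·S₂ − S₂ = (S₁ − S₂) + S₁·diag a·A₂ + A₁·diag a·S₂`; hence
`‖X_rel(x,y)‖ ≤ σ_Δ(x,y) + m·Σ_c σ₁(x,c)‖a_c‖ + m·Σ_c ‖a_c‖σ₂(c,y)`. -/
theorem kltc_relSource_le (S₁ S₂ A₁ A₂ : Matrix ι ι ℂ) (a : ι → ℂ) (σΔ σ₁ σ₂ : ι → ι → ℝ) {m : ℝ} (hm : 0 ≤ m)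
    (hA₁ : ∀ x y, ‖A₁ x y‖ ≤ m) (hA₂ : ∀ x y, ‖A₂ x y‖ ≤ m) (hΔ : ∀ x y, ‖(S₁ - S₂) x y‖ ≤ σΔ x y)
    (hσ₁ : ∀ x y, ‖S₁ x y‖ ≤ σ₁ x y) (hσ₂ : ∀ x y, ‖S₂ x y‖ ≤ σ₂ x y) (x y : ι) :
    ‖(S₁ * (1 + diagonal a * A₂) + A₁ * diagonal a * S₂ - S₂) x y‖ ≤
      σΔ x y + m * ∑ c, σ₁ x c * ‖a c‖ + m * ∑ c, ‖a c‖ * σ₂ c y := by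
  have e : S₁ * (1 + diagonal a * A₂) + A₁ * diagonal a * S₂ - S₂ = (S₁ - S₂) + (S₁ * diagonal a * A₂ + A₁ * diagonal a * S₂) := by
    noncomm_ring
  rw [e, Matrix.add_apply, Matrix.add_apply, add_assoc]
  refine (norm_add_le _ _).trans (add_le_add (hΔ x y) ((norm_add_le _ _).trans (add_le_add ?_ ?_)))
  · rw [klli_mul_diag_mul_apply, Finset.mul_sum]
    refine (norm_sum_le _ _).trans (sum_le_sum fun c _ => ?_)
    rw [norm_mul, norm_mul]
    have h0 : 0 ≤ σ₁ x c := (norm_nonneg _).trans (hσ₁ x c)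
    calc ‖S₁ x c‖ * ‖a c‖ * ‖A₂ c y‖ ≤ σ₁ x c * ‖a c‖ * m :=
          mul_le_mul (mul_le_mul_of_nonneg_right (hσ₁ x c) (norm_nonneg _)) (hA₂ c y) (norm_nonneg _) (mul_nonneg h0 (norm_nonneg _))
      _ = m * (σ₁ x c * ‖a c‖) := by ring
  · rw [klli_mul_diag_mul_apply, Finset.mul_sum]
    refine (norm_sum_le _ _).trans (sum_le_sum fun c _ => ?_)
    rw [norm_mul, norm_mul]
    calc ‖A₁ x c‖ * ‖a c‖ * ‖S₂ c y‖ ≤ m * ‖a c‖ * σ₂ c y :=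
          mul_le_mul (mul_le_mul_of_nonneg_right (hA₁ x c) (norm_nonneg _)) (hσ₂ c y) (norm_nonneg _) (mul_nonneg hm (norm_nonneg _))
      _ = m * (‖a c‖ * σ₂ c y) := by ring

/-- Uniform form of `kltc_relSource_le`: with sups `‖S₁ − S₂‖ ≤ ξ_Δ`, `‖Sᵢ‖ ≤ ξᵢ` the relative source is `≤ ξ_Δ + m·(ξ₁ + ξ₂)·Σ_c‖a_c‖` everywhere. -/
theorem kltc_relSource_le_unif (S₁ S₂ A₁ A₂ : Matrix ι ι ℂ) (a : ι → ℂ) {m ξΔ ξ₁ ξ₂ : ℝ} (hm : 0 ≤ m)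
    (hA₁ : ∀ x y, ‖A₁ x y‖ ≤ m) (hA₂ : ∀ x y, ‖A₂ x y‖ ≤ m) (hΔ : ∀ x y, ‖(S₁ - S₂) x y‖ ≤ ξΔ)
    (hσ₁ : ∀ x y, ‖S₁ x y‖ ≤ ξ₁) (hσ₂ : ∀ x y, ‖S₂ x y‖ ≤ ξ₂) (x y : ι) :
    ‖(S₁ * (1 + diagonal a * A₂) + A₁ * diagonal a * S₂ - S₂) x y‖ ≤ ξΔ + m * (ξ₁ + ξ₂) * ∑ c, ‖a c‖ := by
  refine (kltc_relSource_le S₁ S₂ A₁ A₂ a (fun _ _ => ξΔ) (fun _ _ => ξ₁) (fun _ _ => ξ₂) hm hA₁ hA₂ hΔ hσ₁ hσ₂ x y).trans (le_of_eq ?_)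
  simp only [← Finset.mul_sum, ← Finset.sum_mul]
  ring

variable [Nonempty ι]

/-- **The re-frame door (forward form in, forward form out).**  A forward relation for `(A₁, A₂, a)` with residue `R` and the perturbation majorants of
`kltc_relResidue_perturb_le` give, under the endpoint smallness `m·Σ‖a′‖ ≤ 1/3`, a TWO-SIDED inverse `N` of `1 + diag a′·A₂′` with
`‖(A₁′ − A₂′·N)(x,y)‖ ≤ T(x,y) + Σ_c T(x,c)‖a′_c‖(3m/2)` for every majorant `T` of
`R(x,y) + Σ_c R(x,c)‖a_c‖m + η_rel(x,y) + m·Σ_c η₁(x,c)‖a′_c‖ + m²·Σ_c d_c + m·Σ_c ‖a_c‖η₂(c,y)`. -/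
theorem kltc_fwd_reframe (A₁ A₂ A₁' A₂' M : Matrix ι ι ℂ) (a a' : ι → ℂ) (R ηr η₁ η₂ T : ι → ι → ℝ) (d : ι → ℝ) {m : ℝ} (hm : 0 ≤ m)
    (hA₁ : ∀ x y, ‖A₁ x y‖ ≤ m) (hA₂ : ∀ x y, ‖A₂ x y‖ ≤ m) (hA₂' : ∀ x y, ‖A₂' x y‖ ≤ m)
    (hM : (1 + diagonal a * A₂) * M = 1) (hR : ∀ x y, ‖(A₁ - A₂ * M) x y‖ ≤ R x y)
    (hηr : ∀ x y, ‖((A₁' - A₁) - (A₂' - A₂)) x y‖ ≤ ηr x y)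
    (hη₁ : ∀ x y, ‖(A₁' - A₁) x y‖ ≤ η₁ x y) (hη₂ : ∀ x y, ‖(A₂' - A₂) x y‖ ≤ η₂ x y) (hd : ∀ c, ‖a' c - a c‖ ≤ d c)
    (hsm : m * ∑ c, ‖a' c‖ ≤ 1 / 3)
    (hT : ∀ x y, (R x y + ∑ c, R x c * ‖a c‖ * m) + ηr x y + m * ∑ c, η₁ x c * ‖a' c‖ + m * m * ∑ c, d c +
      m * ∑ c, ‖a c‖ * η₂ c y ≤ T x y) :
    ∃ N : Matrix ι ι ℂ, (1 + diagonal a' * A₂') * N = 1 ∧ N * (1 + diagonal a' * A₂') = 1 ∧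
      ∀ x y, ‖(A₁' - A₂' * N) x y‖ ≤ T x y + ∑ c, T x c * ‖a' c‖ * (3 / 2 * m) := by
  have hE : ∀ x y, ‖(A₁ + A₁ * diagonal a * A₂ - A₂) x y‖ ≤ R x y + ∑ c, R x c * ‖a c‖ * m :=
    kltc_relResidue_le_of_fwd A₁ A₂ M a R hA₂ hM hR
  have hE' : ∀ x y, ‖(A₁' + A₁' * diagonal a' * A₂' - A₂') x y‖ ≤ T x y := fun x y =>
    (kltc_relResidue_perturb_le A₁ A₂ A₁' A₂' a a' (fun x y => R x y + ∑ c, R x c * ‖a c‖ * m) ηr η₁ η₂ d hm hA₁ hA₂' hE hηr hη₁ hη₂ hd x y).trans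
      (hT x y)
  exact kltc_fwd_of_relResidue A₁' A₂' a' T hm hA₂' hsm hE'

end Algebra

/-! ## §2 The history clause in the door's convention and the keyed start supplier -/

section Keyed

variable {L M : ℕ} [NeZero L] [NeZero M]

/-- Re-keying the clause's `1 − diag(t₁ − t₂)·A` as the door's `1 + diag a·A` with `a = −(t₁ − t₂)`. -/
theorem kltc_one_sub_diag_eq_one_add_diag_neg (t : TorusSite 2 L → ℝ) (A : Matrix (TorusSite 2 L) (TorusSite 2 L) ℂ) :
    1 - diagonal (fun p => ((t p : ℝ) : ℂ)) * A = 1 + diagonal (fun p => -(((t p : ℝ)) : ℂ)) * A := by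
  have hd : diagonal (fun p => -(((t p : ℝ)) : ℂ)) = -diagonal (fun p => ((t p : ℝ) : ℂ)) := by
    rw [← diagonal_neg]
  rw [hd, neg_mul, sub_eq_add_neg]

/-- **The history clause in GLOBAL forward form.**  From `PairTransferRelAt … n Tb ψ₁ ψ₂` and a pair class `Qm` at resolution `n`: a two-sided inverse `N` of
`1 + diag aʰ·A₂ʰ` (`aʰ_p = −(t_n[ψ₁](Qm,p) − t_n[ψ₂](Qm,p))`, `Aᵢʰ = klMemberArrayF … n ψᵢ Qm`) with the residue bound EVERYWHERE:
`‖(A₁ʰ − A₂ʰ·N)(x,y)‖ ≤ (if x ∈ ball ∧ y ∈ ball then Tb Qm x y else 0)`. -/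
theorem PairTransferRelAt.fwd_global {β U μ : ℝ} {n : ℕ} {Tb : TorusSite 2 L → TorusSite 2 L → TorusSite 2 L → ℝ}
    {ψ₁ ψ₂ : FreqMomentum L M → ℝ} (h : PairTransferRelAt L M β U μ n Tb ψ₁ ψ₂) {Qm : TorusSite 2 L} (hQm : IsPairClassAt L Qm n) :
    ∃ N : Matrix (TorusSite 2 L) (TorusSite 2 L) ℂ,
      (1 + diagonal (fun p => -(((klTransferWeight L M β μ (klFlowFrameU L M β U μ n) n ψ₁ Qm p -
          klTransferWeight L M β μ (klFlowFrameU L M β U μ n) n ψ₂ Qm p : ℝ)) : ℂ)) * klMemberArrayF L M β U μ n ψ₂ Qm) * N = 1 ∧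
      N * (1 + diagonal (fun p => -(((klTransferWeight L M β μ (klFlowFrameU L M β U μ n) n ψ₁ Qm p -
          klTransferWeight L M β μ (klFlowFrameU L M β U μ n) n ψ₂ Qm p : ℝ)) : ℂ)) * klMemberArrayF L M β U μ n ψ₂ Qm) = 1 ∧
      ∀ x y, ‖(klMemberArrayF L M β U μ n ψ₁ Qm - klMemberArrayF L M β U μ n ψ₂ Qm * N) x y‖ ≤
        (if x ∈ klBall L μ 0 ∧ y ∈ klBall L μ 0 then Tb Qm x y else 0) := by
  obtain ⟨N, h1, h2, hb⟩ := h Qm hQm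
  rw [kltc_one_sub_diag_eq_one_add_diag_neg] at h1 h2
  refine ⟨N, h1, h2, fun x y => ?_⟩
  by_cases hxy : x ∈ klBall L μ 0 ∧ y ∈ klBall L μ 0
  · rw [if_pos hxy, Matrix.sub_apply]
    exact hb x hxy.1 y hxy.2
  · rw [if_neg hxy, Matrix.sub_apply, klMemberArrayF_eq_zero_off β U μ n ψ₁ Qm hxy,
      kltc_mul_rightInv_apply_eq_zero _ _ N (klBall L μ 0) h1 (fun x y h => klMemberArrayF_eq_zero_off β U μ n ψ₂ Qm h) hxy, sub_zero, norm_zero]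

/-- **The keyed START supplier of `pairTransferRelAt_succ` (`hM₀`, `hR₀`).**  From the history clause of the pair `(ψ₁ | ψ₂)` at scale `n` (frame `K_n`), a class
`Qm` at resolution `n`, a priori sizes `|Aᵢʰ| ≤ m` of the history arrays and `|A₂⁰| ≤ m` of the new start array, the five perturbation majorants of the start data
`(A₁⁰, A₂⁰, a⁰)` (the slice flows' `A₁(0), A₂(0), a(0)` — the same members read at the new frame `K_{n+1}`; (F)(i) lane) against the history objects
`(A₁ʰ, A₂ʰ, aʰ)`, and `m·Σ‖a⁰‖ ≤ 1/3`: a two-sided inverse `M₀` of `1 + diag a⁰·A₂⁰` with `‖(A₁⁰ − A₂⁰M₀)(x,y)‖ ≤ T(x,y) + Σ_c T(x,c)‖a⁰_c‖(3m/2)` for every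
majorant `T` of the explicit re-framed residue (history bar on the ball + the relative-smallness terms). -/
theorem PairTransferRelAt.start_reframe {β U μ : ℝ} {n : ℕ} {Tb : TorusSite 2 L → TorusSite 2 L → TorusSite 2 L → ℝ}
    {ψ₁ ψ₂ : FreqMomentum L M → ℝ} (h : PairTransferRelAt L M β U μ n Tb ψ₁ ψ₂) {Qm : TorusSite 2 L} (hQm : IsPairClassAt L Qm n)
    (A₁₀ A₂₀ : Matrix (TorusSite 2 L) (TorusSite 2 L) ℂ) (a₀ : TorusSite 2 L → ℂ) (ηr η₁ η₂ T : TorusSite 2 L → TorusSite 2 L → ℝ)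
    (d : TorusSite 2 L → ℝ) {m : ℝ} (hm : 0 ≤ m)
    (hA₁ : ∀ x y, ‖klMemberArrayF L M β U μ n ψ₁ Qm x y‖ ≤ m) (hA₂ : ∀ x y, ‖klMemberArrayF L M β U μ n ψ₂ Qm x y‖ ≤ m)
    (hA₂₀ : ∀ x y, ‖A₂₀ x y‖ ≤ m)
    (hηr : ∀ x y, ‖((A₁₀ - klMemberArrayF L M β U μ n ψ₁ Qm) - (A₂₀ - klMemberArrayF L M β U μ n ψ₂ Qm)) x y‖ ≤ ηr x y)
    (hη₁ : ∀ x y, ‖(A₁₀ - klMemberArrayF L M β U μ n ψ₁ Qm) x y‖ ≤ η₁ x y)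
    (hη₂ : ∀ x y, ‖(A₂₀ - klMemberArrayF L M β U μ n ψ₂ Qm) x y‖ ≤ η₂ x y)
    (hd : ∀ c, ‖a₀ c - -(((klTransferWeight L M β μ (klFlowFrameU L M β U μ n) n ψ₁ Qm c -
        klTransferWeight L M β μ (klFlowFrameU L M β U μ n) n ψ₂ Qm c : ℝ)) : ℂ)‖ ≤ d c)
    (hsm : m * ∑ c, ‖a₀ c‖ ≤ 1 / 3)
    (hT : ∀ x y, ((if x ∈ klBall L μ 0 ∧ y ∈ klBall L μ 0 then Tb Qm x y else 0) +
        ∑ c, (if x ∈ klBall L μ 0 ∧ c ∈ klBall L μ 0 then Tb Qm x c else 0) *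
          ‖(-(((klTransferWeight L M β μ (klFlowFrameU L M β U μ n) n ψ₁ Qm c -
            klTransferWeight L M β μ (klFlowFrameU L M β U μ n) n ψ₂ Qm c : ℝ)) : ℂ))‖ * m) +
        ηr x y + m * ∑ c, η₁ x c * ‖a₀ c‖ + m * m * ∑ c, d c +
        m * ∑ c, ‖(-(((klTransferWeight L M β μ (klFlowFrameU L M β U μ n) n ψ₁ Qm c -
            klTransferWeight L M β μ (klFlowFrameU L M β U μ n) n ψ₂ Qm c : ℝ)) : ℂ))‖ * η₂ c y ≤ T x y) :
    ∃ M₀ : Matrix (TorusSite 2 L) (TorusSite 2 L) ℂ, (1 + diagonal a₀ * A₂₀) * M₀ = 1 ∧ M₀ * (1 + diagonal a₀ * A₂₀) = 1 ∧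
      ∀ x y, ‖(A₁₀ - A₂₀ * M₀) x y‖ ≤ T x y + ∑ c, T x c * ‖a₀ c‖ * (3 / 2 * m) := by
  obtain ⟨N, h1, -, hR⟩ := h.fwd_global hQm
  exact kltc_fwd_reframe _ _ A₁₀ A₂₀ N _ a₀ _ ηr η₁ η₂ T d hm hA₁ hA₂ hA₂₀ h1 hR hηr hη₁ hη₂ hd hsm hT

end Keyed

end Summit.HubbardSuperconductivity.HubbardSuperconductivity.Theorems.KLRegimeSplit

end
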